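import Mathlib
import HarnessLib
import HarnessLib.Audit
import Summits.KontsevichZagierPeriods.Statement
import HarnessLib.Audit.Status.Attr

/-!
Route: MarkovTreeOfMoves

DORMANT since 2026-08-23T20:48:16Z (reconciler: no traction for 6.2 d (last activity item-evidence-added at 2026-08-17T14:30:20Z); parked, not closed — `ledger route dormant route-KontsevichZagierPeriods-MarkovTreeOfMoves --off` to reac) — unstaffed, not closed; items shared with open routes are served there. `ledger route dormant <id> --off` reactivates.

# Route MarkovTreeOfMoves — mutations are KZ moves — Laurent-period reps, the Markov tree as an
explicit move-graph, and period-sequence completeness as a two-move Conjecture 1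

THE LAURENT SECTOR (card markov-tree-of-moves-mutation-sector). For a Laurent polynomial f ∈
ℚ[x₁^±,…,x_n^±] and a rational t₀
with |t₀|·max_T|f| < 1, the classical period (2π)^n·π_f(t₀) = ∫_{Tⁿ} dθ/(1 − t₀ f(e^{iθ})) is the
value of the KZ-rational
representation R_f(t₀) = [ℝⁿ, J(u)·Re(1/(1 − t₀ f(x(u))))], x_j(u) = (1−u_j²+2iu_j)/(1+u_j²), J(u) =
Π 2/(1+u_j²)
(tan-half-angle chart; literally the shape of KZ §1.1). ENGINE (provable): the two moves of mirror
symmetry's mutation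
calculus are finite chains of H21 moves between these reps — MutationIsAMove (x₀ ↦ x₀·F(x'): the
pullback is free, and the
whole content of ACGK's period invariance is ONE one-directional zero-bulk Stokes block ∂_s g =
−i∂_ψ(g·∂_sρ/ρ) on the
real-radial homotopy ρ = (1−s)+s|F|, plus radial legs and one semialgebraic phase change of
variables) and
MonomialMapIsAMove (x ↦ x^A, A ∈ GL_n(ℤ): one change of variables) — so every mutation graph, e.g.
the MARKOV TREE of
ℙ² (a²+b²+c² = 3abc), is an explicit move-graph of rational reps of fixed dimension and unbounded
complexity.
It suffices to show X = PeriodSequenceMove ∧ LaurentMoveKernel: (i) PeriodSequenceMove (sector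
Conjecture 1, functional
form): CT(f^k) = CT(g^k) for all k ⟹ R_f(t₀) ~ R_g(t₀) at every honest rational t₀ — generated by
the two moves on every
class where Fanosearch's mutation-completeness MC holds (theorem for the 10 del Pezzo classes, the
165 Minkowski buckets,
the 98 reflexive 3-tope classes; conjecture for Fano polygons), attackable unconditionally by
Picard–Fuchs transport;
(ii) LaurentMoveKernel (open core): Conjecture 1 for the calculus enlarged by the period-sequence
move.
Lean: `PeriodSequenceMove ∧ LaurentMoveKernel`

## Assembly
Pure logic, proved as an `example` in the planner's Sketch.lean (rc 0): given PeriodSequenceMove and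
LaurentMoveKernel,
take R := KZ.relations (le_rfl; closure under the period-sequence move is literally
PeriodSequenceMove, since
KZ.Equivalent r r' unfolds to of r − of r' ∈ relations) to get the kernel form ker eval ⊆ relations,
then the summit as
in Theorems/KernelFormKernelImpliesStatement.lean (r.value = r'.value ⇒ eval([r] − [r']) = 0 by
map_sub, eval_of).
MutationIsAMove is the engine behind PeriodSequenceMove on mutation-complete classes and is not a
formal hypothesis of
the assembly.

Rationale: WHY THIS LINE. Mutations (Galkin–Usnich; AkhtarCoatesGalkinKasprzyk2012 §2 Def. 2, Lemma 1 p. 3: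
period invariance via an amoeba-complement
torus, the pulled-back dlog-volume form and homologous cycles) are read through an explicit
dictionary as KZ moves:
GL_n(ℤ) map ↦ one `changeOfVariablesRel` (u'_i = Im z_i/(1+Re z_i), rational, |Jacobian| absorbed by
J); elementary
mutation ↦ EqOn of integrands (pullback) + Newton–Leibniz along the homotopy parameter s with the
pulled-back coefficient
as primitive + "∫ over a full circle of ∂_ψK is a relation" (domain split |u|≤1 / u = 1/v, two
`newtonLeibnizRel`) —
no variable is ever integrated out, so
Literature.Barriers.KontsevichZagierPeriods.noSemialgebraicPrimitive_inv_sub_two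
is not met. Imported area: mirror symmetry for Fano varieties / cluster-type birational
combinatorics (the Fanosearch
programme: CoatesCortiGalkinGolyshevKasprzyk2013; CoatesKasprzykPittonTveiten2021 Thm 3.12, Thm 4.1
and the p. 11
conjecture "the classical period of the general MMLP is a complete invariant for mutation of Fano
polygons";
KasprzykNillPrince2017 Thm 1.2; HackingProkhorov2010 for the Markov triples), whose classification
theorems become
"two moves suffice" theorems here and whose conjecture MC becomes a typed two-move Conjecture 1 with
INTEGER shadows
(period sequences c_k = CT(f^k) ∈ ℤ; in-sector functional equality decidable by certified
Picard–Fuchs operators,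
Lairez2015, BostanLairezSalvy2013). What prior routes do not do: GaussManinCertificates transports
along t inside ONE
pencil; MultivaluedCoV derives isogeny correspondences (the CM/elliptic analogue); this line moves
BETWEEN pencils
f ↦ g at fixed small t₀ and supplies the first infinite certified family (the Markov tree) of
fixed-dimension rational
identities with explicit chains; the negatives index is empty.

RANKED CRUXES. #2 MutationIsAMove (crux) — (card M1/M2, theorem-candidate) for Laurent polynomials
f, g, F over ℚ in n+1 variables with F ≠ 0 not involving x₀ and g(x) = f(x₀·F(x), x₁, …, x_n)
wherever F(x) ≠ 0 on the complex torus (an elementary algebraic mutation in adapted coordinates),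
there is δ > 0 such that for every rational t₀ with |t₀| < δ the torus-period representations
R_f(t₀), R_g(t₀) on ℝⁿ⁺¹ (tan-half-angle chart) are KZ-equivalent. Plan: radial Stokes legs to
rational radii in the amoeba complement of F; phase change of variables u₀' = Im z/(Re z + |z|), z =
x₀(u₀)F(x'(u')); one-directional Stokes block on ρ₀ = ε₀((1−s)+s|F(x')|): [T, G(1,·)] − [T, G(0,·)]
= NL along s, ∂_s(J·Re g) = ∂_{u₀}K with K = J'·Im(g ∂_sρ/ρ) semialgebraic, killed by split + 1/v
chart + two NL moves; δ⁻¹ = sup of |f| over the compact union of homotopies. [difficulty: L] (why it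
might fail: F may vanish or wind on the unit torus (the card's h = 1+xy² vanishes): the chain needs
rational radii in the amoeba complement, radial legs and a semialgebraic non-rational phase CoV;
Lean risk = IsSemialgebraicFunOn + integrability of √(rational) composites on ℝⁿ⁺¹×[0,1].)
[AkhtarCoatesGalkinKasprzyk2012, KontsevichZagierPeriods2001, CoatesKasprzykPittonTveiten2021]
#3 PeriodSequenceMove (crux) — (card M3 read through the dictionary; the sector Conjecture 1 in
functional form) for Laurent polynomials f, g ∈ ℚ[x₁^±,…,x_n^±] with equal period sequences, CT(f^k)
= CT(g^k) for all k, and every rational t₀ with |t₀ f| < 1 and |t₀ g| < 1 on the unit torus, the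
representations R_f(t₀) and R_g(t₀) are KZ-equivalent. On every class where mutation-completeness
holds it follows from MutationIsAMove + MonomialMapIsAMove (+ CoveringIsAMove for sublattices) by
Equivalent.trans along the mutation chain; unconditionally the attack is Picard–Fuchs transport from
the trivial fibre t = 0 (coefficient identities = ConstantTermMove) with rational
creative-telescoping certificates. [deps: MutationIsAMove, MonomialMapIsAMove, ConstantTermMove]
[difficulty: XL] (why it might fail: It is Conjecture 1 on a sector (false only with the summit).
Informative risks: t = 0 is a singular (MUM) point of the Picard–Fuchs operator, so transport from
the trivial fibre needs a singular-point bootstrap; outside rigid-MMLP classes no combinatorial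
chain is even conjectured.) [CoatesKasprzykPittonTveiten2021, AkhtarCoatesGalkinKasprzyk2012,
Lairez2015, BostanLairezSalvy2013, KontsevichZagierPeriods2001]
#4 LaurentMoveKernel (crux) — OPEN CORE. Conjecture 1 for the calculus enlarged by the
period-sequence move: every subgroup R ≥ KZ.relations that contains [R_f(t₀)] − [R_g(t₀)] for all
equal-period-sequence pairs (f, g) and honest rational t₀ contains ker KZ.eval. KZKernelConjecture ⇒
it (take R ≥ relations = ker); it ∧ PeriodSequenceMove ⇒ KZKernelConjecture (R := relations) — the
Assembly. Its use: positive items of every KontsevichZagierPeriods route may be proved with mutation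
/ period-sequence moves as admissible steps. [deps: PeriodSequenceMove] [difficulty: open-problem]
(why it might fail: Summit-strength (KZKernelConjecture ⇒ it; with PeriodSequenceMove it is the
kernel form): the three GPC-strength barriers apply verbatim, and Laurent-sector relations are
functional identities that do not touch Neg's pressure points (regularisation, Γ-detours).)
[KontsevichZagierPeriods2001, HuberMullerStachPeriods2017, Ayoub2015, CressonViusos2022]
#9 MonomialMapIsAMove (support) — (card dictionary arrow (i)) for A ∈ GL_n(ℤ) and g(x) = f(x^A) on
the complex torus, R_f(t₀) ~ R_g(t₀) for every rational t₀ with |t₀ f| < 1 on the unit torus: cut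
the null seams {Re z_i = −1} by domain additivity, then ONE changeOfVariablesRel u ↦ u' with u'_i =
Im z_i/(1 + Re z_i), z = x(u)^A (rational, injective since x ↦ x^A is a bijection of the torus, J(u)
= J(u')·|det| because both are the Haar density). [difficulty: M] [AkhtarCoatesGalkinKasprzyk2012,
KontsevichZagierPeriods2001]
#9 CoveringIsAMove (support) — (planner's addition: the third move of the sub-calculus) for m ≥ 1
and g(x) = f(x₀^m, x₁, …, x_n), R_f(t₀) ~ R_g(t₀) for every honest rational t₀: domain additivity
into the m arcs tan(kπ/m) < … (algebraic endpoints), m changes of variables by the tangent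
multiple-angle map (each arc covers the circle once and yields [ℝⁿ⁺¹, P_f/m]), and m−1
integrand-additivity moves. It records why mutation-completeness must be stated with the exponent
lattice N_f = ℤⁿ (f(x,y) and f(x,y²) have equal period sequences and are not mutation-equivalent).
[difficulty: M] [AkhtarCoatesGalkinKasprzyk2012, CoatesKasprzykPittonTveiten2021]
#9 ConstantTermMove (support) — (the integer shadow, provable now) for every Laurent polynomial f
over ℚ, [ℝⁿ, J·Re f(x(u))] ~ [ℝⁿ, J·CT(f)]: f − CT(f) is a sum of monomials c·x^v with v ≠ 0, and
J·Re(x^v) = J'·∂_{u_j}(sin⟨v,θ(u)⟩/v_j)-type derivative for any j with v_j ≠ 0, killed by the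
one-directional block (split + 1/v chart + two NL moves); integrand additivity assembles the sum.
These are the coefficient identities ∮ f^k = (2π)^n c_k behind the period sequence. [difficulty:
provable-now] [AkhtarCoatesGalkinKasprzyk2012, KontsevichZagierPeriods2001]
#9 MarkovFirstEdge (support) — (card M1, corrected after the triage refuter's check) the first edge
of the Markov tree at t₀ = 1/10: the ℙ² mirror f₀ = x + y + 1/(xy) (c_{3k} = (3k)!/k!³) and its
mutation g = x(1+xy²)² + 1/(xy) = x + 2x²y² + x³y⁴ + 1/(xy) along φ(x,y) = (x·h², y/h), h = 1 + xy²
(w = (2,−1)); CT(g^k) = CT(f₀^k) checked for k ≤ 12. h vanishes on the unit torus, so the chain is: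
radial leg to radii (1/2, 1) (|h| ∈ [1/2, 3/2] there), phase CoV, mutation homotopy λ_s = (1−s)+s|h|
with |x| = λ²/2, |y| = 1/λ, radial leg back; along it |f₀|, |g| ≤ 5.0 numerically (grid 120²×11;
crude hand bound 9/8 + 2 + 4 = 7.125) < 10, so t₀ = 1/10 is pole-free with margin. [difficulty: L]
[AkhtarCoatesGalkinKasprzyk2012, HackingProkhorov2010, KontsevichZagierPeriods2001]

TWO-LAYER PLAN. Foreseen glued splits (k ≤ 3, depth 1), filed only when a crux closes or stalls with
a census:
MutationIsAMove ⇐ CircleDerivativeIsARelation ([ℝⁿ×band, ∂_{u_j}K] ∈ relations for K semialgebraic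
and continuous on
the circle: split + 1/v chart + two NL) → RadialMove (ρ constant in θ: R_f on radii ε ~ R_f on radii
ε') →
MutationIsAMove (glue: Equivalent.trans of radial legs, phase CoV, mutation homotopy);
PeriodSequenceMove ⇐ PeriodSequenceMoveMC (on a class where MC is a theorem: the 10 del Pezzo
classes) →
PicardFuchsTransport (shared with route GaussManinCertificates: KZStokes + flat transport with
rational certificates,
singular-point bootstrap at t = 0) → PeriodSequenceMove; the informal crux MutationCompleteness ⇐
per
singularity-content class (KasprzykNillPrince2017 finiteness of minimal polygons).

KILL CRITERIA. A refutation of MutationIsAMove, MonomialMapIsAMove, CoveringIsAMove,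
ConstantTermMove or MarkovFirstEdge exhibits two
KZ-rational representations with EQUAL values (AkhtarCoatesGalkinKasprzyk2012 Lemma 1) that are not
KZ-equivalent, i.e.
¬KontsevichZagierPeriods: close `refuted:<Decl>` and hand the witness to route Neg (it would be the
first typed Neg pair,
dimension n, rational integrands). PeriodSequenceMove refuted = the same in the functional sector.
LaurentMoveKernel
refuted ⇒ (with PeriodSequenceMove) ¬summit. Refutation of the informal MutationCompleteness (two
rigid MMLPs with equal
period sequence, not mutation-equivalent) is NOT a kill: it yields the typed pair 'accessible by
Conjecture 1,
inaccessible by the sub-calculus' (filed then as a support KZ.Equivalent item) and sharpens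
PeriodSequenceMove.
KZKernelConjecture proved elsewhere moots LaurentMoveKernel and PeriodSequenceMove but not the
engines (explicit chains,
proof-length data).

NOT DECOMPOSED YET. General (non-adapted) mutations mut_w(f, F) = GL-conjugates of the elementary
one (MonomialMapIsAMove ∘ MutationIsAMove ∘
MonomialMapIsAMove by Equivalent.trans); IsRational of the torus reps (routine prover lemma, needed
only at the summit
interface); the Markov tree beyond its first edge (induction along HackingProkhorov2010 / ACGK
triples (a,b,c) →
(a,b,3ab−c) = Equivalent.trans of MutationIsAMove instances); the chain-length-versus-tree-distance
question (card M6)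
and the database scan for equal-period / different-singularity-content pairs (card M5, kit) — not
items until a
candidate exists; decidability of π_f ≡ π_g (Lairez2015 indicial bounds; card M4) — a cite fact, not
an item; the
rigid-MMLP vocabulary (definition request) before MutationCompleteness can be typed.

CHEAPEST FALSIFIER. (i) MarkovFirstEdge: expand CT(g^k) for k ≤ 12 against (3k)!/k!³ (done by the
triage refuter: 1, 0, 0, 6, 0, 0, 90, 0, 0,
1680, 0, 0, 34650 ✓) and bound |f₀|, |g| on the stated chain (radii (1/2,1), λ ∈ [1/2,3/2]: ≤ 9/8 +
2 + 4 = 7.125 < 10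
by hand, 5.0 on a 120²×11 grid in plain python this session). (ii) MutationIsAMove: the symbolic
identity
∂_s[1/(1 − t f(ρe^{iψ}, x'))] = −i ∂_ψ[(∂_sρ/ρ)/(1 − t f(ρe^{iψ}, x'))] for ρ independent of ψ
(checked by hand:
both sides equal g² t (∂₀f) e^{iψ} ∂_sρ); if it failed the Stokes block would be multi-directional
(longer, not dead).
(iii) Lookup (done, negative): no work on the Kontsevich–Zagier conjecture (zbMATH, 9 works)
mentions mutations, and
ACGK/CKPT/KNP never mention Conjecture 1. The line dies only if a mutation invariant were a KZ
invariant — impossible once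
MutationIsAMove is proved — or if the engines' typed hypotheses admit a degenerate instance (F = 0
is excluded explicitly).

NUMBERS. Markov tree: a² + b² + c² = 3abc, ℙ² ⇝ ℙ(a², b², c²) (HackingProkhorov2010); π_{f₀} = Σ
(3k)!/k!³ t^{3k} (1, 6, 90, 1680,
34650, …). Mutation-completeness data: 165 period buckets of 3-dimensional Minkowski polynomials,
all mutation-connected,
first 8 coefficients suffice (AkhtarCoatesGalkinKasprzyk2012 §5, Cor. 3); 10 mutation classes of
Fano polygons with
T-singularities ↔ 10 del Pezzo families (KasprzykNillPrince2017 Thm 1.2;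
CoatesKasprzykPittonTveiten2021 Thm 3.12);
98 mutation classes of rigid MMLPs on the 4319 reflexive 3-topes ↔ 98 Fano 3-folds, 105 with rigid
MMLP mirrors
(CoatesKasprzykPittonTveiten2021 Thm 4.1); Ex. 3.15 there: ℙ¹×ℙ¹ vs 𝔽₁, equal singularity content
(4, ∅), periods
1+4t²+36t⁴+… ≠ 1+2t²+6t³+…. Calibration: t₀ = 1/10; sup of |f₀|, |g| over the whole chain = 5.0
numerically (hand bound 7.125); CT(f₀^k) = CT(g^k) re-checked here for k ≤ 9
(1,0,0,6,0,0,90,0,0,1680) and the identity g = f₀(x h², y/h) to 2e-16. Items at open: 8 typed (3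
cruxes,
4 support, 1 assembly) + 1 informal crux (MutationCompleteness, rank 5) and 2 definition requests
filed right after.

DEFINITION REQUESTS. notion IsMutationEquivalent (topic Literature/AlgebraicGeometry/Mutations):
Laurent polynomials over ℚ in n variables
(AddMonoidAlgebra ℚ (Fin n → ℤ)) related by a finite composite of GL_n(ℤ) monomial maps and
elementary mutations
x₀ ↦ x₀·F(x') with Laurent output (AkhtarCoatesGalkinKasprzyk2012 Def. 2, Rem. 2). notion
IsRigidMMLP (same topic):
maximally mutable Laurent polynomial + rigidity (CoatesKasprzykPittonTveiten2021 §§2–3). Both are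
needed to type the
informal crux MutationCompleteness (rank 5): "rigid MMLPs f, g with N_f = N_g = ℤⁿ and π_f = π_g are
mutation-equivalent"
(theorem on the classes listed under Numbers, conjecture for Fano polygons,
CoatesKasprzykPittonTveiten2021 p. 11).
Cite facts wanted: ACGK Lemma 1 (period invariance) and §5 (165 buckets); Lairez2015 (certified
Picard–Fuchs operator
and indicial bound ⇒ π_f ≡ π_g decidable from finitely many c_k).

Novelty: Searches (2026-08-15, this session): `lit search --source zbmath "Kontsevich Zagier period
conjecture"` (9 works:
KontsevichZagierPeriods2001, André 2009, Ayoub2015, Huber–Wüstholz 2022, CressonViusos2022, Viu-Sos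
2021, Terasoma 2010,
Moerman 2022, arXiv:2507.15020 — none mentions mutations or Laurent-polynomial periods); `lit search
--source zbmath
"mutations Laurent polynomials Fano"` (2: arXiv:1212.1785, arXiv:2504.04486); full texts of
arXiv:1212.1785,
arXiv:2107.14253, arXiv:1501.05335 materialised and grepped for Zagier / period conjecture / Stokes
(0 hits);
`lit frontier KontsevichZagierPeriods --since 2020` (30 rows, MZV / odd zeta / GPC, nothing toric);
`lit bridges
KontsevichZagierPeriods --cross any`; `lit galaxy search "Kontsevich-Zagier" --star pdf` (10 hits:
HMS book,
Huber–Wüstholz, Glanois thesis, Tapušković …, none on mutations); `lit galaxy search … --star all`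
twice saturated
(queued > 90 s), OpenAlex/S2 rate-limited — recorded; the card's own galaxy searches
("mutation-equivalent Laurent
polynomials", "maximally mutable", "period sequence") returned 0 relevant hits; hub: 10 route files
and the negatives
index read (no mutation/Laurent/Fano item anywhere).
Nearest prior art found: arXiv:1212.1785 (AkhtarCoatesGalkinKasprzyk2012) Lemma 1 — period
invariance under mutation by
cycle deformation, the analytic shadow of MutationIsAMove; arXiv:2107.14253
(CoatesKasprzykPittonTveiten2021) Thm 3.12,
Thm 4.1 and the p. 11 completeness conjecture, arXiv:1501.05335 (K  [refs: 10.1090/mcom/3054, 2507.15020, 1212.1785, 2504.04486, 2107.14253, 1501.05335, doi:10.1090/mcom/3054, KontsevichZagierPeriods2001, Ayoub2015, CressonViusos2022, AkhtarCoatesGalkinKasprzyk2012, CoatesKasprzykPittonTveiten2021, KasprzykNillPrince2017, Lairez2015]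

Barriers (technique_class: sub-calculus-completeness, semialgebraic-stokes): - technique_class: sub-calculus-completeness, semialgebraic-stokes
- Literature.Barriers.KontsevichZagierPeriods.noSemialgebraicPrimitive_inv_sub_two: evaded
structurally — no variable is integrated out anywhere on the line; every rule-3 instance is
Newton–Leibniz along the homotopy parameter with the pulled-back coefficient itself as primitive, or
along a circle coordinate with the explicit semialgebraic K = J'·Im(g ∂_sρ/ρ) as primitive
(zero-bulk Stokes); the barrier's scope (elimination of a variable needs a transcendental primitive)
is exactly what the dictionary never asks for.
- Literature.Barriers.KontsevichZagierPeriods.kzConjecture_implies_oddZetaAlgIndep: applies verbatim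
to LaurentMoveKernel only (summit-strength, admitted open core); MutationIsAMove,
MonomialMapIsAMove, CoveringIsAMove, ConstantTermMove, MarkovFirstEdge and PeriodSequenceMove assert
derivability of identities between representations already known to have equal values and prove no
number transcendental.
- Literature.Barriers.KontsevichZagierPeriods.kzConjecture_implies_twoPiI_log_algIndep: same —
confined to LaurentMoveKernel.
- Literature.Barriers.KontsevichZagierPeriods.kzConjecture_implies_ellipticPeriods_algIndep: same —
confined to LaurentMoveKernel; the genus-1 pencils Y_f → ℙ¹ of 2-variable MMLPs
(CoatesKasprzykPittonTveiten2021 Thm 3.13) enter only through functional identities.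
- Literature.Barriers.KontsevichZagierPeriods.cressonViuSos_prop_3_2: not engaged — no global (PL or
semialgebrai

History (route lifecycle, newest last):
- 2026-08-23T20:48:16Z · DORMANT — reconciler: no traction for 6.2 d (last activity item-evidence-added at 2026-08-17T14:30:20Z); parked, not closed — `ledger route dormant route-KontsevichZagier (operator:999:1724420)

sub-problem: KontsevichZagierPeriods · status: dormant · opened planner-plancard-KontsevichZagierPeriods-Kont-bf34d97d-0 2026-08-15T11:34:29Z · rev 1 · ledger route-KontsevichZagierPeriods-MarkovTreeOfMoves
GENERATED by the gate from the ledger (D-0016/17). Provers cite these decls: `theorem foo : Summit.KontsevichZagierPeriods.KontsevichZagierPeriods.Theses.MarkovTreeOfMoves.<Decl> := …` in Summits/KontsevichZagierPeriods/KontsevichZagierPeriods/Theorems/<Name>.lean.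
-/

namespace Summit.KontsevichZagierPeriods.KontsevichZagierPeriods.Theses.MarkovTreeOfMoves

open scoped BigOperators Topology Manifold Classical MeasureTheory ProbabilityTheory Matrix InnerProductSpace ComplexConjugate ContinuousMap
open Filter Set Function TopologicalSpace MeasureTheory

attribute [summit_statement] _root_.KontsevichZagierPeriods

open Literature Periods

/-- item stmt-KontsevichZagierPeriods-4540 · crux · rank 2 · open · by planner
why it might fail: F may vanish or wind on the unit torus (the card's h = 1+xy² vanishes): the chain needs rational radii in the amoeba complement, radial legs and a semialgebraic non-rational phase CoV; Lean risk = IsSemialgebraicFunOn + integrability of √(rational) composites on ℝⁿ⁺¹×[0,1].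
sources: AkhtarCoatesGalkinKasprzyk2012, KontsevichZagierPeriods2001, CoatesKasprzykPittonTveiten2021
[crux] (card M1/M2, theorem-candidate) for Laurent polynomials f, g, F over ℚ in n+1 variables with
F ≠ 0 not involving x₀ and g(x) = f(x₀·F(x), x₁, …, x_n) wherever F(x) ≠ 0 on the complex torus (an
elementary algebraic mutation in adapted coordinates), there is δ > 0 such that for every rational
t₀ with |t₀| < δ the torus-period representations R_f(t₀), R_g(t₀) on ℝⁿ⁺¹ (tan-half-angle chart)
are KZ-equivalent. Plan: radial Stokes legs to rational radii in the amoeba complement of F; phase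
change of variables u₀' = Im z/(Re z + |z|), z = x₀(u₀)F(x'(u')); one-directional Stokes block on ρ₀
= ε₀((1−s)+s|F(x')|): [T, G(1,·)] − [T, G(0,·)] = NL along s, ∂_s(J·Re g) = ∂_{u₀}K with K = J'·Im(g
∂_sρ/ρ) semialgebraic, killed by split + 1/v chart + two NL moves; δ⁻¹ = sup of |f| over the compact
union of homotopies. [difficulty: L] -/
@[route_item "route-KontsevichZagierPeriods-MarkovTreeOfMoves"]
def MutationIsAMove : Prop :=
  ∀ (n : ℕ) (ev : AddMonoidAlgebra ℚ (Fin (n + 1) → ℤ) → (Fin (n + 1) → ℂ) → ℂ) (tc : (Fin (n + 1) → ℝ) → (Fin (n + 1) → ℂ)) (J : (Fin (n + 1) → ℝ) → ℝ), (∀ f x, ev f x = f.coeff.sum (fun v c => (c : ℂ) * ∏ i, x i ^ (v i))) → (∀ u i, tc u i = (((1 - u i ^ 2 : ℝ) : ℂ) + ((2 * u i : ℝ) : ℂ) * Complex.I) / ((1 + u i ^ 2 : ℝ) : ℂ)) → (∀ u, J u = ∏ i, 2 / (1 + u i ^ 2)) → ∀ (f g F : AddMonoidAlgebra ℚ (Fin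 (n + 1) → ℤ)), F ≠ 0 → (∀ v ∈ F.coeff.support, v 0 = 0) → (∀ x : Fin (n + 1) → ℂ, (∀ i, x i ≠ 0) → ev F x ≠ 0 → ev g x = ev f (Function.update x 0 (x 0 * ev F x))) → ∃ δ : ℝ, 0 < δ ∧ ∀ t₀ : ℚ, |(t₀ : ℝ)| < δ → ∀ (r r' : Literature.NumberTheory.Transcendental.KZ.IntegralRep (n + 1)), r.domain = Set.univ → (∀ u, r.integrand u = J u * (1 / (1 - (t₀ : ℂ) * ev f (tc u))).re) → r'.domain = Set.univ → (∀ u, r'.integrand u = J u * (1 / (1 - (t₀ : ℂ) * ev g (tc u))).re) → Literature.NumberTheory.Transcendental.KZ.Equivalent r r'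

/-- item stmt-KontsevichZagierPeriods-4541 · crux · rank 3 · open · by planner
why it might fail: It is Conjecture 1 on a sector (false only with the summit). Informative risks: t = 0 is a singular (MUM) point of the Picard–Fuchs operator, so transport from the trivial fibre needs a singular-point bootstrap; outside rigid-MMLP classes no combinatorial chain is even conjectured.
sources: CoatesKasprzykPittonTveiten2021, AkhtarCoatesGalkinKasprzyk2012, Lairez2015, BostanLairezSalvy2013, KontsevichZagierPeriods2001
[crux] (card M3 read through the dictionary; the sector Conjecture 1 in functional form) for Laurent
polynomials f, g ∈ ℚ[x₁^±,…,x_n^±] with equal period sequences, CT(f^k) = CT(g^k) for all k, and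
every rational t₀ with |t₀ f| < 1 and |t₀ g| < 1 on the unit torus, the representations R_f(t₀) and
R_g(t₀) are KZ-equivalent. On every class where mutation-completeness holds it follows from
MutationIsAMove + MonomialMapIsAMove (+ CoveringIsAMove for sublattices) by Equivalent.trans along
the mutation chain; unconditionally the attack is Picard–Fuchs transport from the trivial fibre t =
0 (coefficient identities = ConstantTermMove) with rational creative-telescoping certificates.
[deps: MutationIsAMove, MonomialMapIsAMove, ConstantTermMove] [difficulty: XL] -/
@[route_item "route-KontsevichZagierPeriods-MarkovTreeOfMoves", crux]
def PeriodSequenceMove : Prop :=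
  ∀ (n : ℕ) (ev : AddMonoidAlgebra ℚ (Fin n → ℤ) → (Fin n → ℂ) → ℂ) (tc : (Fin n → ℝ) → (Fin n → ℂ)) (J : (Fin n → ℝ) → ℝ), (∀ f x, ev f x = f.coeff.sum (fun v c => (c : ℂ) * ∏ i, x i ^ (v i))) → (∀ u i, tc u i = (((1 - u i ^ 2 : ℝ) : ℂ) + ((2 * u i : ℝ) : ℂ) * Complex.I) / ((1 + u i ^ 2 : ℝ) : ℂ)) → (∀ u, J u = ∏ i, 2 / (1 + u i ^ 2)) → ∀ (f g : AddMonoidAlgebra ℚ (Fin n → ℤ)), (∀ k : ℕ, (f ^ k).coeff 0 = (g ^ k).coeff 0) → ∀ t₀ : ℚ, (∀ x : Fin n → ℂ, (∀ i, ‖x i‖ = 1) → ‖(t₀ : ℂ) * ev f x‖ < 1 ∧ ‖(t₀ : ℂ) * ev g x‖ < 1) → ∀ (r r' : Literature.NumberTheory.Transcendental.KZ.IntegralRep n), r.domain = Set.univ → (∀ u, r.integrand u = J u * (1 / (1 - (t₀ : ℂ) * ev f (tc u))).re) → r'.domain = Set.univ → (∀ u, r'.integrand u = J u * (1 / (1 -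 (t₀ : ℂ) * ev g (tc u))).re) → Literature.NumberTheory.Transcendental.KZ.Equivalent r r'

/-- item stmt-KontsevichZagierPeriods-4542 · crux · rank 4 · open · by planner
why it might fail: Summit-strength (KZKernelConjecture ⇒ it; with PeriodSequenceMove it is the kernel form): the three GPC-strength barriers apply verbatim, and Laurent-sector relations are functional identities that do not touch Neg's pressure points (regularisation, Γ-detours).
sources: KontsevichZagierPeriods2001, HuberMullerStachPeriods2017, Ayoub2015, CressonViusos2022
[crux] OPEN CORE. Conjecture 1 for the calculus enlarged by the period-sequence move: every subgroup
R ≥ KZ.relations that contains [R_f(t₀)] − [R_g(t₀)] for all equal-period-sequence pairs (f, g) and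
honest rational t₀ contains ker KZ.eval. KZKernelConjecture ⇒ it (take R ≥ relations = ker); it ∧
PeriodSequenceMove ⇒ KZKernelConjecture (R := relations) — the Assembly. Its use: positive items of
every KontsevichZagierPeriods route may be proved with mutation / period-sequence moves as
admissible steps. [deps: PeriodSequenceMove] [difficulty: open-problem] -/
@[route_item "route-KontsevichZagierPeriods-MarkovTreeOfMoves", crux]
def LaurentMoveKernel : Prop :=
  ∀ (R : AddSubgroup Literature.NumberTheory.Transcendental.KZ.FormalRep), Literature.NumberTheory.Transcendental.KZ.relations ≤ R → (∀ (n : ℕ) (ev : AddMonoidAlgebra ℚ (Fin n → ℤ) → (Fin n → ℂ) → ℂ) (tc : (Fin n → ℝ) → (Fin n → ℂ)) (J : (Fin n → ℝ) → ℝ), (∀ f x, ev f x = f.coeff.sum (fun v c => (c : ℂ) * ∏ i, x i ^ (v i))) → (∀ u i, tc u i = (((1 - u i ^ 2 : ℝ) : ℂ) + ((2 * u i : ℝ) : ℂ) * Complex.I) / ((1 + u i ^ 2 : ℝ) : ℂ)) → (∀ u, J u = ∏ i, 2 / (1 + u i ^ 2)) → ∀ (f g : AddMonoidAlgebra ℚ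 (Fin n → ℤ)), (∀ k : ℕ, (f ^ k).coeff 0 = (g ^ k).coeff 0) → ∀ t₀ : ℚ, (∀ x : Fin n → ℂ, (∀ i, ‖x i‖ = 1) → ‖(t₀ : ℂ) * ev f x‖ < 1 ∧ ‖(t₀ : ℂ) * ev g x‖ < 1) → ∀ (r r' : Literature.NumberTheory.Transcendental.KZ.IntegralRep n), r.domain = Set.univ → (∀ u, r.integrand u = J u * (1 / (1 - (t₀ : ℂ) * ev f (tc u))).re) → r'.domain = Set.univ → (∀ u, r'.integrand u = J u * (1 / (1 - (t₀ : ℂ) * ev g (tc u))).re) → Literature.NumberTheory.Transcendental.KZ.of r - Literature.NumberTheory.Transcendental.KZ.of r' ∈ R) → ∀ c : Literature.NumberTheory.Transcendental.KZ.FormalRep, Literature.NumberTheory.Transcendental.KZ.eval c = 0 → c ∈ R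

-- item stmt-KontsevichZagierPeriods-5306 · support · rank 5 · open · by planner — informal only, no Lean statement yet:
--   [crux] MUTATION-COMPLETENESS (card M3; the imported Fanosearch conjecture MC, informal until the
--   definition requests IsMutationEquivalent / IsRigidMMLP land). Two rigid maximally-mutable Laurent
--   polynomials f, g ∈ ℚ[x₁^±,…,x_n^±] whose exponents generate ℤⁿ (N_f = N_g = ℤⁿ, excluding coverings
--   — see CoveringIsAMove) and whose classical periods agree, π_f = π_g (equivalently CT(f^k) = CT(g^k)
--   for all k; in-sector decidable from finitely many k by a certified Picard–Fuchs operator,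
--   Lairez2015), are related by a finite composite of GL_n(ℤ) monomial maps and elementary mutations x₀
--   ↦ x₀·F(x') (Akh

/-- item stmt-KontsevichZagierPeriods-4543 · support · rank 9 · open · by planner
sources: AkhtarCoatesGalkinKasprzyk2012, KontsevichZagierPeriods2001
[support] (card dictionary arrow (i)) for A ∈ GL_n(ℤ) and g(x) = f(x^A) on the complex torus,
R_f(t₀) ~ R_g(t₀) for every rational t₀ with |t₀ f| < 1 on the unit torus: cut the null seams {Re
z_i = −1} by domain additivity, then ONE changeOfVariablesRel u ↦ u' with u'_i = Im z_i/(1 + Re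
z_i), z = x(u)^A (rational, injective since x ↦ x^A is a bijection of the torus, J(u) = J(u')·|det|
because both are the Haar density). [difficulty: M] -/
@[route_item "route-KontsevichZagierPeriods-MarkovTreeOfMoves"]
def MonomialMapIsAMove : Prop :=
  ∀ (n : ℕ) (ev : AddMonoidAlgebra ℚ (Fin n → ℤ) → (Fin n → ℂ) → ℂ) (tc : (Fin n → ℝ) → (Fin n → ℂ)) (J : (Fin n → ℝ) → ℝ), (∀ f x, ev f x = f.coeff.sum (fun v c => (c : ℂ) * ∏ i, x i ^ (v i))) → (∀ u i, tc u i = (((1 - u i ^ 2 : ℝ) : ℂ) + ((2 * u i : ℝ) : ℂ) * Complex.I) / ((1 + u i ^ 2 : ℝ) : ℂ)) → (∀ u, J u = ∏ i, 2 / (1 + u i ^ 2)) → ∀ (A : Matrix (Fin n) (Fin n) ℤ), IsUnit A.det → ∀ (f g : AddMonoidAlgebra ℚ (Fin n → ℤ)), (∀ x : Fin n → ℂ, (∀ i, x i ≠ 0) → ev g x = ev f (fun i => ∏ j, x j ^ (A i j))) → ∀ t₀ : ℚ, (∀ x : Fin n → ℂ, (∀ i, ‖x i‖ = 1) → ‖(t₀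 : ℂ) * ev f x‖ < 1) → ∀ (r r' : Literature.NumberTheory.Transcendental.KZ.IntegralRep n), r.domain = Set.univ → (∀ u, r.integrand u = J u * (1 / (1 - (t₀ : ℂ) * ev f (tc u))).re) → r'.domain = Set.univ → (∀ u, r'.integrand u = J u * (1 / (1 - (t₀ : ℂ) * ev g (tc u))).re) → Literature.NumberTheory.Transcendental.KZ.Equivalent r r'

/-- item stmt-KontsevichZagierPeriods-4544 · support · rank 9 · open · by planner
sources: AkhtarCoatesGalkinKasprzyk2012, CoatesKasprzykPittonTveiten2021
[support] (planner's addition: the third move of the sub-calculus) for m ≥ 1 and g(x) = f(x₀^m, x₁,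
…, x_n), R_f(t₀) ~ R_g(t₀) for every honest rational t₀: domain additivity into the m arcs tan(kπ/m)
< … (algebraic endpoints), m changes of variables by the tangent multiple-angle map (each arc covers
the circle once and yields [ℝⁿ⁺¹, P_f/m]), and m−1 integrand-additivity moves. It records why
mutation-completeness must be stated with the exponent lattice N_f = ℤⁿ (f(x,y) and f(x,y²) have
equal period sequences and are not mutation-equivalent). [difficulty: M] -/
@[route_item "route-KontsevichZagierPeriods-MarkovTreeOfMoves"]
def CoveringIsAMove : Prop :=
  ∀ (n : ℕ) (ev : AddMonoidAlgebra ℚ (Fin (n + 1) → ℤ) → (Fin (n + 1) → ℂ) → ℂ) (tc : (Fin (n + 1) → ℝ) → (Fin (n + 1) → ℂ)) (J : (Fin (n + 1) → ℝ) → ℝ), (∀ f x, ev f x = f.coeff.sum (fun v c => (c : ℂ) * ∏ i, x i ^ (v i))) → (∀ u i, tc u i = (((1 - u i ^ 2 : ℝ) : ℂ) + ((2 * u i : ℝ) : ℂ) * Complex.I) / ((1 + u i ^ 2 : ℝ) : ℂ)) → (∀ u, J u = ∏ i, 2 / (1 + u i ^ 2)) → ∀ (m : ℕ), 1 ≤ m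 → ∀ (f g : AddMonoidAlgebra ℚ (Fin (n + 1) → ℤ)), (∀ x : Fin (n + 1) → ℂ, (∀ i, x i ≠ 0) → ev g x = ev f (Function.update x 0 (x 0 ^ m))) → ∀ t₀ : ℚ, (∀ x : Fin (n + 1) → ℂ, (∀ i, ‖x i‖ = 1) → ‖(t₀ : ℂ) * ev f x‖ < 1) → ∀ (r r' : Literature.NumberTheory.Transcendental.KZ.IntegralRep (n + 1)), r.domain = Set.univ → (∀ u, r.integrand u = J u * (1 / (1 - (t₀ : ℂ) * ev f (tc u))).re) → r'.domain = Set.univ → (∀ u, r'.integrand u = J u * (1 / (1 - (t₀ : ℂ) * ev g (tc u))).re) → Literature.NumberTheory.Transcendental.KZ.Equivalent r r'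

/-- item stmt-KontsevichZagierPeriods-4545 · support · rank 9 · open · by planner
sources: AkhtarCoatesGalkinKasprzyk2012, KontsevichZagierPeriods2001
[support] (the integer shadow, provable now) for every Laurent polynomial f over ℚ, [ℝⁿ, J·Re
f(x(u))] ~ [ℝⁿ, J·CT(f)]: f − CT(f) is a sum of monomials c·x^v with v ≠ 0, and J·Re(x^v) =
J'·∂_{u_j}(sin⟨v,θ(u)⟩/v_j)-type derivative for any j with v_j ≠ 0, killed by the one-directional
block (split + 1/v chart + two NL moves); integrand additivity assembles the sum. These are the
coefficient identities ∮ f^k = (2π)^n c_k behind the period sequence. [difficulty: provable-now] -/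
@[route_item "route-KontsevichZagierPeriods-MarkovTreeOfMoves"]
def ConstantTermMove : Prop :=
  ∀ (n : ℕ) (ev : AddMonoidAlgebra ℚ (Fin n → ℤ) → (Fin n → ℂ) → ℂ) (tc : (Fin n → ℝ) → (Fin n → ℂ)) (J : (Fin n → ℝ) → ℝ), (∀ f x, ev f x = f.coeff.sum (fun v c => (c : ℂ) * ∏ i, x i ^ (v i))) → (∀ u i, tc u i = (((1 - u i ^ 2 : ℝ) : ℂ) + ((2 * u i : ℝ) : ℂ) * Complex.I) / ((1 + u i ^ 2 : ℝ) : ℂ)) → (∀ u, J u = ∏ i, 2 / (1 + u i ^ 2)) → ∀ (f : AddMonoidAlgebra ℚ (Fin n → ℤ)) (r r' : Literature.NumberTheory.Transcendental.KZ.IntegralRep n), r.domain = Set.univ → (∀ u, r.integrand u = J u * (ev f (tc u)).re) → r'.domain = Set.univ → (∀ u, r'.integrand u = J u * (f.coeff 0 : ℝ)) → Literature.NumberTheory.Transcendental.KZ.Equivalent r r'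

/-- item stmt-KontsevichZagierPeriods-4546 · support · rank 9 · open · by planner
sources: AkhtarCoatesGalkinKasprzyk2012, HackingProkhorov2010, KontsevichZagierPeriods2001
[support] (card M1, corrected after the triage refuter's check) the first edge of the Markov tree at
t₀ = 1/10: the ℙ² mirror f₀ = x + y + 1/(xy) (c_{3k} = (3k)!/k!³) and its mutation g = x(1+xy²)² +
1/(xy) = x + 2x²y² + x³y⁴ + 1/(xy) along φ(x,y) = (x·h², y/h), h = 1 + xy² (w = (2,−1)); CT(g^k) =
CT(f₀^k) checked for k ≤ 12. h vanishes on the unit torus, so the chain is: radial leg to radii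
(1/2, 1) (|h| ∈ [1/2, 3/2] there), phase CoV, mutation homotopy λ_s = (1−s)+s|h| with |x| = λ²/2,
|y| = 1/λ, radial leg back; along it |f₀|, |g| ≤ 5.0 numerically (grid 120²×11; crude hand bound 9/8
+ 2 + 4 = 7.125) < 10, so t₀ = 1/10 is pole-free with margin. [difficulty: L] -/
@[route_item "route-KontsevichZagierPeriods-MarkovTreeOfMoves"]
def MarkovFirstEdge : Prop :=
  ∀ (tc : (Fin 2 → ℝ) → (Fin 2 → ℂ)) (J : (Fin 2 → ℝ) → ℝ), (∀ u i, tc u i = (((1 - u i ^ 2 : ℝ) : ℂ) + ((2 * u i : ℝ) : ℂ) * Complex.I) / ((1 + u i ^ 2 : ℝ) : ℂ)) → (∀ u, J u = ∏ i, 2 / (1 + u i ^ 2)) → ∀ (r r' : Literature.NumberTheory.Transcendental.KZ.IntegralRep 2), r.domain = Set.univ → (∀ u, r.integrand u = J u * (1 / (1 - (1 / 10 : ℂ) * (tc u 0 + tc u 1 + 1 / (tc u 0 * tc u 1)))).re) → r'.domain = Set.univ → (∀ u, r'.integrand u = J u * (1 / (1 - (1 / 10 : ℂ) * (tc u 0 +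 2 * tc u 0 ^ 2 * tc u 1 ^ 2 + tc u 0 ^ 3 * tc u 1 ^ 4 + 1 / (tc u 0 * tc u 1)))).re) → Literature.NumberTheory.Transcendental.KZ.Equivalent r r'

/-- item stmt-KontsevichZagierPeriods-4547 · assembly · rank 1 · closed · proved by Summit.KontsevichZagierPeriods.MarkovTreeOfMoves.assembly_proof @ 4c4d066f9e15 (prover) · by planner
sources: KontsevichZagierPeriods2001, HuberMullerStachPeriods2017
[assembly] PeriodSequenceMove → LaurentMoveKernel → KontsevichZagierPeriods. -/
@[route_item "route-KontsevichZagierPeriods-MarkovTreeOfMoves"]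
def Assembly : Prop :=
  PeriodSequenceMove → LaurentMoveKernel → KontsevichZagierPeriods

/-! D-0027 §2.1 — DECIDING THEOREM (planner-authored via `route open/edit --closes-file`; by planner-rbadge-KontsevichZagierPeriods-MarkovT-057e9b87-g2-0 2026-08-15T16:12:39Z):
its hypotheses are this route's items and its conclusion the sub-problem Statement (glue_lint), and it elaborates with this file. -/

@[closes "route-KontsevichZagierPeriods-MarkovTreeOfMoves"] theorem closes : PeriodSequenceMove → LaurentMoveKernel → KontsevichZagierPeriods := by
  intro hP hK n m r r' _ _ hv
  have h0 : Literature.NumberTheory.Transcendental.KZ.eval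
      (Literature.NumberTheory.Transcendental.KZ.of r - Literature.NumberTheory.Transcendental.KZ.of r') = 0 := by
    simp [Literature.NumberTheory.Transcendental.KZ.eval_of, hv]
  exact hK Literature.NumberTheory.Transcendental.KZ.relations le_rfl
    (fun k ev tc J hev htc hJ f g hk t₀ ht ρ ρ' hρ hρi hρ' hρ'i =>
      hP k ev tc J hev htc hJ f g hk t₀ ht ρ ρ' hρ hρi hρ' hρ'i) _ h0

end Summit.KontsevichZagierPeriods.KontsevichZagierPeriods.Theses.MarkovTreeOfMoves
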